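import Literature.Analysis.OperatorTheory.KreinNegativeSquares
import Summits.RiemannHypothesis.RiemannHypothesis.Theorems.Splittings.ScrewNodeReduction
import Summits.RiemannHypothesis.RiemannHypothesis.Theorems.Splittings.ScrewNullCombInertia
import HarnessLib

/-!
# Screw index transfer via Kreĭn definitizability — statement `IndexTransferKrein` and its reduction to the
# analytic core (Theorem B of `cards/SPLIT-screw-bridge.md` §10-U, kernel steps (1)+(2))

Cell `rh-split`, seat `rh-split-screw-bridge` g5 (scratch `ScrewBridgeG5e.lean` sha16 82a653698ab61cb9, re-cut
against the Literature named fact `Literature.Analysis.OperatorTheory.Stewart1972_thm_3_1`).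

* `IndexTransferKrein : Prop` — the target «Kreĭn's definitizability theorem ⟹ (IndexBounded ⟹
  CofiniteCriticalLine)», where `IndexBounded := ∃ K, ∀ n, #{negative eigenvalues of the screw node matrix S_n}
  ≤ K` (tree `ScrewNullComb.etail_iff_boundedIndex`: `IndexBounded ⟺ ETAIL := ∃ M₀, ∀ M ≥ M₀, 0 < screwPivot M`).
* `etail_iff_foz_of_indexTransferKrein` — bookkeeping: `IndexTransferKrein`, the named fact and the tree's
  `ScrewNullComb.etail_iff_foz_iff_indexTransfer` give `ETAIL ⟺ CofiniteCriticalLine` (T2 of the card).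
* KERNEL STEPS (1)+(2) of Theorem B: `exists_meanZero_negFamily` (a real symmetric matrix with `≥ q+1`
  negative eigenvalues carries `q` MEAN-ZERO vectors spanning a negative-definite subspace: eigenvector span
  `∩ {Σ_p v_p = 0}`, rank–nullity) and `negIndexLE_of_indexBounded` (with the tree's node reduction
  `ScrewBridgeG5.negIndex_ge_of_atomicWitness` + `kernelForm_eq_of_sum_eq_zero`): a uniform bound `K` on
  `#neg(S_n)` bounds the negative index of EVERY matrix `[−Ψ(x_p − x_q)]` (`x ∈ ℝ^r` arbitrary) by `K + 1`,
  i.e. `f = −Ψ` (viewed in `ℝ → ℂ`) satisfies the HYPOTHESES of `Stewart1972_thm_3_1` with some exact index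
  `k ≤ K + 1` (`exists_exactIndex`); `card_negEigenvalues_map_algebraMap` transports the count from the real
  symmetric matrix to its complexification (same characteristic roots).
* `indexTransferKrein_of_core` — hence `IndexTransferKrein` REDUCES to the analytic core
  `Stewart1972_thm_3_1 → ∀ k, (hypotheses of the fact for f = −Ψ with exact index k) → CofiniteCriticalLine`
  (card §10-U U2 steps (3)–(6): mollified exponential-polynomial structure of `Q(i d/dx)Q̄(i d/dx)(χ ∗ f)`,
  Suzuki's series `Ψ(t) = Σ_ρ m_ρ (cosh((ρ−½)t) − 1)/(ρ−½)²` (tree `Suzuki2023_thm11_series_holds`), Laplace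
  pole count `#{Re ρ > ½} ≤ 2k`) — successor work, NOT in this file.

Sources: M. G. Kreĭn, Dokl. Akad. Nauk SSSR 125 (1959) 31–34; J. Stewart, Canad. Math. Bull. 15 (1972) 399–410,
Thm 2.4 + Thm 3.1 (doi:10.4153/cmb-1972-073-9); M. Suzuki, arXiv:2206.03682 Thm 1.1/11.1, arXiv:2308.11860 §3.1.
No sorry, no new axioms; nothing here is a claim about RH.
-/

set_option linter.dupNamespace false

noncomputable section

namespace Summit.RiemannHypothesis.RiemannHypothesis.Theorems.Splittings.ScrewIndexTransferKrein

open Finset Complex Matrix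
open Literature.NumberTheory.LFunctions
open Literature.Analysis.OperatorTheory
open Summit.RiemannHypothesis.RiemannHypothesis.Theses.RuelleBand
open Summit.RiemannHypothesis.RiemannHypothesis.Theorems.IntegerScrew

/-! ## The target statement and the bookkeeping -/

/-- TARGET (card `SPLIT-screw-bridge.md` §10-U, Theorem B packaged against the named fact): Kreĭn's
definitizability theorem (`Stewart1972_thm_3_1`) implies that a uniform bound on the negative index of the screw
node matrices forces all but finitely many zeta zeros onto the critical line.  Proved on paper (§10-U U2);
kernel: steps (1)+(2) below, steps (3)–(6) open (`indexTransferKrein_of_core` isolates them). -/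
def IndexTransferKrein : Prop :=
  Stewart1972_thm_3_1 →
    (∃ K : ℕ, ∀ n : ℕ, (univ.filter fun i => (screwMatrix_isHermitian n).eigenvalues i < 0).card ≤ K) →
      CofiniteCriticalLine

/-- Bookkeeping: with `IndexTransferKrein` and the named fact, T2 «ETAIL ⟺ FOZ» follows from the tree's
`ScrewNullComb.etail_iff_foz_iff_indexTransfer`. [new-combination] -/
theorem etail_iff_foz_of_indexTransferKrein (h2 : IndexTransferKrein) (h1 : Stewart1972_thm_3_1) :
    (∃ M₀ : ℕ, ∀ M : ℕ, M₀ ≤ M → 0 < screwPivot M) ↔ CofiniteCriticalLine :=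
  ScrewNullComb.etail_iff_foz_iff_indexTransfer.mpr (h2 h1)

/-! ## Linear algebra: mean-zero negative families; real vs complexified negative index -/

/-- A real symmetric matrix with at least `q+1` negative eigenvalues admits `q` mean-zero vectors spanning a
subspace on which its quadratic form is negative definite. [folklore] -/
theorem exists_meanZero_negFamily {r : ℕ} (A : Matrix (Fin r) (Fin r) ℝ) (hA : A.IsHermitian) (q : ℕ)
    (hq : q + 1 ≤ (univ.filter fun i => hA.eigenvalues i < 0).card) :
    ∃ α : Fin q → Fin r → ℝ, (∀ k, ∑ p, α k p = 0) ∧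
      ∀ c : Fin q → ℝ, c ≠ 0 →
        ∑ p, ∑ p', (∑ k, c k * α k p) * (∑ k, c k * α k p') * A p p' < 0 := by
  classical
  have hcardN : q + 1 ≤ Fintype.card {i : Fin r // hA.eigenvalues i < 0} := by
    rwa [Fintype.card_subtype]
  set N := {i : Fin r // hA.eigenvalues i < 0} with hNdef
  let e : Fin r → Fin r → ℝ := fun i => ⇑(hA.eigenvectorBasis i)
  have he_orth : ∀ i j : Fin r, e i ⬝ᵥ e j = if i = j then 1 else 0 := by
    intro i j
    have h := (orthonormal_iff_ite.mp hA.eigenvectorBasis.orthonormal) j i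
    rw [EuclideanSpace.inner_eq_star_dotProduct, star_trivial] at h
    rw [eq_comm] at h ⊢
    simpa [eq_comm] using h.symm
  have he_eig : ∀ i : Fin r, A *ᵥ e i = hA.eigenvalues i • e i := fun i => hA.mulVec_eigenvectorBasis i
  let L : (N → ℝ) →ₗ[ℝ] (Fin r → ℝ) :=
    { toFun := fun d => ∑ i : N, d i • e (i : Fin r)
      map_add' := fun d d' => by
        simp only [Pi.add_apply, add_smul, sum_add_distrib]
      map_smul' := fun a d => by
        simp only [Pi.smul_apply, smul_eq_mul, RingHom.id_apply, smul_sum, smul_smul] }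
  have hL : ∀ d : N → ℝ, L d = ∑ i : N, d i • e (i : Fin r) := fun d => rfl
  have hform : ∀ d : N → ℝ,
      ∑ p, ∑ p', (L d) p * (L d) p' * A p p' = ∑ i : N, hA.eigenvalues (i : Fin r) * d i ^ 2 := by
    intro d
    have h1 : ∑ p, ∑ p', (L d) p * (L d) p' * A p p' = L d ⬝ᵥ (A *ᵥ L d) := by
      simp only [dotProduct, mulVec, mul_sum]
      refine sum_congr rfl fun p _ => sum_congr rfl fun p' _ => by ring
    have h2 : A *ᵥ L d = ∑ j : N, (d j * hA.eigenvalues (j : Fin r)) • e (j : Fin r) := by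
      rw [hL, Matrix.mulVec_sum]
      refine sum_congr rfl fun j _ => ?_
      rw [Matrix.mulVec_smul, he_eig, smul_smul]
    rw [h1, h2, dotProduct_sum]
    refine sum_congr rfl fun j _ => ?_
    rw [dotProduct_smul, hL, sum_dotProduct]
    have h3 : ∑ i : N, d i • e (i : Fin r) ⬝ᵥ e (j : Fin r) = d j := by
      simp_rw [smul_dotProduct, he_orth, smul_eq_mul, mul_ite, mul_one, mul_zero]
      rw [Finset.sum_eq_single j]
      · rw [if_pos rfl]
      · intro b _ hb
        rw [if_neg (fun h => hb (Subtype.ext h))]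
      · intro h; exact absurd (mem_univ j) h
    rw [h3]; ring
  have hformneg : ∀ d : N → ℝ, d ≠ 0 → ∑ i : N, hA.eigenvalues (i : Fin r) * d i ^ 2 < 0 := by
    intro d hd
    obtain ⟨i₀, hi₀⟩ : ∃ i, d i ≠ 0 := by
      by_contra h
      exact hd (funext fun i => not_not.mp fun hi => h ⟨i, hi⟩)
    have hle : ∀ i ∈ (univ : Finset N), hA.eigenvalues (i : Fin r) * d i ^ 2 ≤ 0 := fun i _ =>
      mul_nonpos_iff.mpr (Or.inr ⟨le_of_lt i.2, sq_nonneg _⟩)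
    have hlt : ∃ i ∈ (univ : Finset N), hA.eigenvalues (i : Fin r) * d i ^ 2 < 0 :=
      ⟨i₀, mem_univ _, mul_neg_of_neg_of_pos i₀.2 (lt_of_le_of_ne (sq_nonneg _) (Ne.symm (pow_ne_zero 2 hi₀)))⟩
    simpa using Finset.sum_lt_sum hle hlt
  let s : (Fin r → ℝ) →ₗ[ℝ] ℝ :=
    { toFun := fun v => ∑ p, v p
      map_add' := fun v w => by simp only [Pi.add_apply, sum_add_distrib]
      map_smul' := fun a v => by simp only [Pi.smul_apply, smul_eq_mul, RingHom.id_apply, mul_sum] }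
  have hs : ∀ v : Fin r → ℝ, s v = ∑ p, v p := fun v => rfl
  let W : Submodule ℝ (N → ℝ) := LinearMap.ker (s ∘ₗ L)
  have hW : q ≤ Module.finrank ℝ W := by
    show q ≤ Module.finrank ℝ (LinearMap.ker (s ∘ₗ L))
    have h0 : q + 1 ≤ Fintype.card N := hcardN
    have h1 := LinearMap.finrank_range_add_finrank_ker (s ∘ₗ L)
    have h2 : Module.finrank ℝ (LinearMap.range (s ∘ₗ L)) ≤ 1 := by
      calc Module.finrank ℝ (LinearMap.range (s ∘ₗ L)) ≤ Module.finrank ℝ ℝ := Submodule.finrank_le _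
        _ = 1 := Module.finrank_self ℝ
    have h3 : Module.finrank ℝ (N → ℝ) = Fintype.card N := Module.finrank_fintype_fun_eq_card ℝ
    omega
  let B := Module.finBasis ℝ W
  let b : Fin q → N → ℝ := fun k => (B (Fin.castLE hW k) : N → ℝ)
  have hbW : ∀ k, s (L (b k)) = 0 := fun k => by
    have := (B (Fin.castLE hW k)).2
    exact this
  have hbli : LinearIndependent ℝ b := by
    have h1 : LinearIndependent ℝ (fun k : Fin q => B (Fin.castLE hW k)) :=
      B.linearIndependent.comp _ (Fin.castLE_injective hW)
    exact h1.map' W.subtype (Submodule.ker_subtype W)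
  refine ⟨fun k p => L (b k) p, fun k => by rw [← hs]; exact hbW k, fun c hc => ?_⟩
  set d : N → ℝ := ∑ k, c k • b k with hd
  have hd0 : d ≠ 0 := by
    intro h0
    apply hc
    funext k
    exact Fintype.linearIndependent_iff.mp hbli c (by rw [← hd]; exact h0) k
  have hcomb : ∀ p, ∑ k, c k * L (b k) p = L d p := by
    intro p
    rw [hd, map_sum, Finset.sum_apply]
    refine sum_congr rfl fun k _ => ?_
    rw [map_smul, Pi.smul_apply, smul_eq_mul]
  simp_rw [hcomb]
  rw [hform d]
  exact hformneg d hd0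

/-- A real symmetric matrix and its complexification have the same number of negative eigenvalues (same
characteristic roots). [folklore] -/
theorem card_negEigenvalues_map_algebraMap {r : ℕ} (A : Matrix (Fin r) (Fin r) ℝ) (hA : A.IsHermitian)
    (hC : (A.map (algebraMap ℝ ℂ)).IsHermitian) :
    (univ.filter fun i => hC.eigenvalues i < 0).card = (univ.filter fun i => hA.eigenvalues i < 0).card := by
  classical
  -- the multisets of eigenvalues coincide
  have hmul : Multiset.map hC.eigenvalues univ.val = Multiset.map hA.eigenvalues univ.val := by
    have h1 := hC.roots_charpoly_eq_eigenvalues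
    have h2 := hA.roots_charpoly_eq_eigenvalues
    rw [Matrix.charpoly_map, hA.splits_charpoly.roots_map, h2, Multiset.map_map] at h1
    have h3 : Multiset.map (RCLike.ofReal ∘ hC.eigenvalues) univ.val =
        Multiset.map ((algebraMap ℝ ℂ) ∘ hA.eigenvalues) univ.val := by
      rw [← h1]
      refine Multiset.map_congr rfl fun i _ => ?_
      simp only [Function.comp_apply, RCLike.ofReal_real_eq_id, id_eq]
    have h4 : Multiset.map ((algebraMap ℝ ℂ) ∘ hA.eigenvalues) univ.val =
        Multiset.map (RCLike.ofReal ∘ hA.eigenvalues) univ.val :=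
      Multiset.map_congr rfl fun i _ => congrFun RCLike.algebraMap_eq_ofReal _
    rw [h4, ← Multiset.map_map, ← Multiset.map_map RCLike.ofReal hA.eigenvalues] at h3
    exact Multiset.map_injective RCLike.ofReal_injective h3
  have key : ∀ g : Fin r → ℝ,
      (univ.filter fun i => g i < 0).card = (Multiset.map g univ.val).countP fun t => t < 0 := by
    intro g
    rw [Multiset.countP_map, Finset.card_def, Finset.filter_val]
  rw [key, key, hmul]

/-- Negative-eigenvalue counts of (propositionally) equal matrices agree. [folklore] -/
theorem card_negEigenvalues_congr {r : ℕ} {M M' : Matrix (Fin r) (Fin r) ℂ} (h : M = M')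
    (hM : M.IsHermitian) (hM' : M'.IsHermitian) :
    (univ.filter fun i => hM.eigenvalues i < 0).card = (univ.filter fun i => hM'.eigenvalues i < 0).card := by
  subst h; rfl

/-! ## Steps (1)+(2) of Theorem B: `IndexBounded ⟹` the hypotheses of the Kreĭn fact for `f = −Ψ` -/

/-- `f = −Ψ` viewed as a complex-valued function on `ℝ`. -/
theorem negScrewC_symm : ∀ t : ℝ,
    (fun u : ℝ => ((-zetaScrew u : ℝ) : ℂ)) (-t) = (starRingEnd ℂ) ((fun u : ℝ => ((-zetaScrew u : ℝ) : ℂ)) t) :=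
  fun t => by simp only [zetaScrew_neg, Complex.conj_ofReal]

/-- The real kernel matrix `[−Ψ(x_p − x_q)]` is symmetric. [folklore] -/
theorem negScrewMatrix_isHermitian (r : ℕ) (x : Fin r → ℝ) :
    (Matrix.of fun p q : Fin r => -zetaScrew (x p - x q)).IsHermitian := by
  refine Matrix.IsHermitian.ext fun p q => ?_
  simp only [Matrix.of_apply, star_trivial]
  rw [← neg_sub (x p) (x q), zetaScrew_neg]

/-- **Kernel steps (1)+(2) of Theorem B.**  A uniform bound `K` on the negative index of the node truncations
`S_n` bounds the negative index of every kernel matrix `[−Ψ(x_p − x_q)]`, `x ∈ ℝ^r`, by `K + 1` — stated for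
the complexified matrices exactly as in the hypothesis of `Stewart1972_thm_3_1`.  Node reduction
(`ScrewBridgeG5.negIndex_ge_of_atomicWitness`, `kernelForm_eq_of_sum_eq_zero`) + `exists_meanZero_negFamily`.
[new-combination] -/
theorem negIndexLE_of_indexBounded (K : ℕ)
    (hK : ∀ n : ℕ, (univ.filter fun i => (screwMatrix_isHermitian n).eigenvalues i < 0).card ≤ K)
    (r : ℕ) (x : Fin r → ℝ) :
    (univ.filter fun i =>
      (kreinKernelMatrix_isHermitian (fun u : ℝ => ((-zetaScrew u : ℝ) : ℂ)) negScrewC_symm r x).eigenvalues i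
        < 0).card ≤ K + 1 := by
  classical
  -- transport to the real symmetric matrix
  have hmat : (Matrix.of fun p q : Fin r => (fun u : ℝ => ((-zetaScrew u : ℝ) : ℂ)) (x p - x q)) =
      (Matrix.of fun p q : Fin r => -zetaScrew (x p - x q)).map (algebraMap ℝ ℂ) := by
    ext p q
    simp only [Matrix.of_apply, Matrix.map_apply, Complex.coe_algebraMap]
  have hC : ((Matrix.of fun p q : Fin r => -zetaScrew (x p - x q)).map (algebraMap ℝ ℂ)).IsHermitian := by
    rw [← hmat]; exact kreinKernelMatrix_isHermitian (fun u : ℝ => ((-zetaScrew u : ℝ) : ℂ)) negScrewC_symm r x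
  rw [card_negEigenvalues_congr hmat _ hC,
    card_negEigenvalues_map_algebraMap _ (negScrewMatrix_isHermitian r x) hC]
  -- the real statement
  by_contra h
  have hq : (K + 1) + 1 ≤
      (univ.filter fun i => (negScrewMatrix_isHermitian r x).eigenvalues i < 0).card := by omega
  obtain ⟨α, hmean, hneg⟩ := exists_meanZero_negFamily _ _ (K + 1) hq
  have hnegK : ∀ c : Fin (K + 1) → ℝ, c ≠ 0 →
      ∑ p, ∑ p', (∑ k, c k * α k p) * (∑ k, c k * α k p') * zetaScrewKernel (x p) (x p') < 0 := by
    intro c hc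
    have hβ : ∑ p, ∑ k, c k * α k p = 0 := by
      rw [Finset.sum_comm]
      exact sum_eq_zero fun k _ => by rw [← mul_sum, hmean k, mul_zero]
    rw [ScrewBridgeG5.kernelForm_eq_of_sum_eq_zero (fun p => ∑ k, c k * α k p) hβ x]
    have h := hneg c hc
    simp only [Matrix.of_apply] at h
    rw [← sum_neg_distrib]
    convert h using 2 with p _
    rw [← sum_neg_distrib]
    refine sum_congr rfl fun p' _ => by ring
  obtain ⟨N, hN⟩ := ScrewBridgeG5.negIndex_ge_of_atomicWitness (K + 1) r x α hmean hnegK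
  have h1 := hN N le_rfl
  have h2 := hK N
  omega

/-- From «at most `K+1` everywhere» to Kreĭn's «exactly `k` somewhere and at most `k` everywhere» for some
`k ≤ K + 1` (the empty configuration realises `0`). [folklore] -/
theorem exists_exactIndex (K : ℕ)
    (hK : ∀ n : ℕ, (univ.filter fun i => (screwMatrix_isHermitian n).eigenvalues i < 0).card ≤ K) :
    ∃ k : ℕ, k ≤ K + 1 ∧
      (∀ (r : ℕ) (x : Fin r → ℝ), (univ.filter fun i =>
        (kreinKernelMatrix_isHermitian (fun u : ℝ => ((-zetaScrew u : ℝ) : ℂ)) negScrewC_symm r x).eigenvalues i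
          < 0).card ≤ k) ∧
      (∃ (r : ℕ) (x : Fin r → ℝ), (univ.filter fun i =>
        (kreinKernelMatrix_isHermitian (fun u : ℝ => ((-zetaScrew u : ℝ) : ℂ)) negScrewC_symm r x).eigenvalues i
          < 0).card = k) := by
  classical
  let cnt : (r : ℕ) → (Fin r → ℝ) → ℕ := fun r x => (univ.filter fun i =>
    (kreinKernelMatrix_isHermitian (fun u : ℝ => ((-zetaScrew u : ℝ) : ℂ)) negScrewC_symm r x).eigenvalues i
      < 0).card
  let P : ℕ → Prop := fun k => ∃ (r : ℕ) (x : Fin r → ℝ), cnt r x = k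
  refine ⟨Nat.findGreatest P (K + 1), Nat.findGreatest_le _, fun r x => ?_, ?_⟩
  · exact Nat.le_findGreatest (negIndexLE_of_indexBounded K hK r x) ⟨r, x, rfl⟩
  · have h0 : P 0 := ⟨0, Fin.elim0, by simp [cnt]⟩
    exact Nat.findGreatest_spec (Nat.zero_le _) h0

/-- **KB2 reduces to its analytic core** (card §10-U U2 steps (3)–(6), successor work): it suffices to derive
`CofiniteCriticalLine` from the named fact together with ITS OWN HYPOTHESES for `f = −Ψ` and some exact index
`k`. [new-combination] -/
theorem indexTransferKrein_of_core
    (hcore : Stewart1972_thm_3_1 → ∀ k : ℕ,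
      (∀ (r : ℕ) (x : Fin r → ℝ), (univ.filter fun i =>
        (kreinKernelMatrix_isHermitian (fun u : ℝ => ((-zetaScrew u : ℝ) : ℂ)) negScrewC_symm r x).eigenvalues i
          < 0).card ≤ k) →
      (∃ (r : ℕ) (x : Fin r → ℝ), (univ.filter fun i =>
        (kreinKernelMatrix_isHermitian (fun u : ℝ => ((-zetaScrew u : ℝ) : ℂ)) negScrewC_symm r x).eigenvalues i
          < 0).card = k) →
      CofiniteCriticalLine) :
    IndexTransferKrein := fun h1 ⟨K, hK⟩ => by
  obtain ⟨k, -, hle, hex⟩ := exists_exactIndex K hK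
  exact hcore h1 k hle hex

end Summit.RiemannHypothesis.RiemannHypothesis.Theorems.Splittings.ScrewIndexTransferKrein

end
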